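import Summits.BirchSwinnertonDyer.Rank1Residual.Additive.X4RankZeroVisibleRefinedCertificateSockets
import Summits.BirchSwinnertonDyer.Rank1Residual.GaloisImage.VisThreeESideInstancesP1
import Summits.BirchSwinnertonDyer.Rank1Residual.GaloisImage.LocalThreeTorsionAdicCompletion
import Summits.BirchSwinnertonDyer.Rank1Residual.GaloisImage.LocalTorsionAwayFromPAdicCompletion
import Summits.BirchSwinnertonDyer.Rank1Residual.GaloisImage.PadicTwistClassDecider
import Summits.BirchSwinnertonDyer.Rank1Residual.Additive.IntModelTamagawaCertificateLocal
import Summits.BirchSwinnertonDyer.Rank1Residual.Additive.JValuationOfIntModel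
import Summits.BirchSwinnertonDyer.Rank1Residual.X11b.VisibilityPrimeList
import Literature.NumberTheory.EllipticCurves.HondaStrongIsomorphismMultiplicativeProofs
import HarnessLib

/-!
# T-NSK-REC PILOT ROW SHAPE: `BSD(E,3)` for `62514b1` from its `3`-CONGRUENT rank-2 partner `2718f1`
# over the REFINED seven-kind certificate — the place `3` PAID (`t₃ = 1`), the place `23` FREE of
# kind (iv′) (E non-split multiplicative, E′ good), every local binder IN THE KERNEL
# (cell `b2b-bsdres`, team n1011, ROW T-2LL FILE 7 = the T-NSK-REC pilot of lead R5-86 (r); route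
# planner 1 ROUTE-1 §41.9 road PASS⁺ (`+268` rows: "kind (iv′) nonsplit-mult / good, t_w = 3");
# seat p04 GEN 11; token-for-token the shape of n1011-p18's `X4ThreeVisibleRowShape7704q1.lean` and
# n1011-p14's `X4ThreeVisibleTateRowShape6165g1.lean`, over FILE 6's socket
# `X4RankZero.bsdp_three_potMult_of_congr_of_places₇_of_primeList_paidThree`)

HONEST FRAMING (cell `b2b-bsdres`, run/shared/lean/b2b/bsd-rank1-residual/, verbatim in every
file): the goal of the cell is to DELETE the COMBINATION-SHAPED residual classes of the
Birch–Swinnerton-Dyer formula for ALL analytic-rank `≤ 1` elliptic curves over `ℚ` — "full BSD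
formula for every rank `≤ 1` curve in class `C`" assembled STRICTLY from published theorems — so
that the rank-`≤ 1` remainder becomes exactly the CONSTRUCTION-SHAPED classes, which are TYPED
(missing-input `Prop`s), NOT attempted. This is not "finishing BSD". Team n1011 (N11 = X4 ∧ `p = 3`),
research route; a ROW SHAPE closes NO class and moves no mark / label / count; nothing booked;
theorems only (no definition, no named fact, no `sorry`).

RULING OF RECORD for row shapes (n1011 lead GEN 8, R5-82 (d), verbatim): "T-VIS3 (iv) ROW SHAPE —
evidence columns displayed as binders, provenance: θ = r1 g29 tables (+ KO/Fisher certificate when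
landed), rank E′ = Cremona/bsdr2, r_an/#Ш_an = Cremona allbsd + engine P; nothing booked; closes
nothing beyond its displayed binders; census count unchanged".

## What

**`bsdp3_visN_v62514b1`** — the N11 row `62514b1 = [1, -1, 0, -27902781, 56737833925]`
(`N = 62514 = 2·3²·23·151`; X4 at `3`, (M): Kodaira `I₄*`, `ord₃ j = -4`; `r_an = 0`,
`ord₃ #Ш_an = 2`) with the `3`-congruent partner `2718f1 = [1, -1, 0, -99, 409]` of Mordell–Weil rank
`2` (Cremona–Mazur 2000 Table 1, `2718F`; route planner 1 `g29_cvis_pairs.tsv`: places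
`2:nonsplit/nonsplit:3:iii; 3:add-pm/add-pm:1:PAY3; 23:nonsplit/good:3:PAID; 151:nonsplit/nonsplit:1:i`,
verdict `FAIL@23(nonsplit/good,t=3)` on the crude count, PASS⁺ once the place `23` is FREE of kind
(iv′) — `E` non-split multiplicative facing `E′` good, `23 ≠ 3`: the local Kummer conditions then
AGREE, [MilneADT2006] I.3.8 / n1011-p04 `NonsplitKummer.*`).  The place `3` is PAID: `#E′(ℚ₃)[3] = 1`
(n1011-p17's decider, instance `LocalTorsion3.natCard_ker_nsmul_three_adicCompletion_eq_one_2718f1`,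
reused BY NAME), cost `1 · #(ℤ₃/3ℤ₃) = 3 < 3² ≤ 3^{rank E′}`.  KERNEL: surj(3) = n1011-p14's
`GaloisImage.surj3_frob_v62514b1` (E-INST-P1, BY NAME); X4 and `ord₃ j < 0` from the integer model;
`E′` globally minimal (bounded Kraus criterion); `S` = places over `[2, 3, 23, 151]`
(`|Δ(E)| = 2⁸·3¹⁰·23³·151`, `|Δ(E′)| = 2²·3⁷·151`); the place `2` of kind (iii) (both multiplicative:
`2 ∣ Δ`, `2 ∤ c₄` on both models; same twist class `γ(E)/γ(E′) = 1829678371735/960339968112679`, a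
`2`-adic unit square, `sqFlagAt 2 (N·D) 0 = true`; `μ₃(ℚ₂) = 1`, `sqFlagAt 2 (−3) 0 = false`); the
place `23` of kind (iv′) (`23³ ∥ Δ(E)`, `23 ∤ c₄(E) = 1339333497`; `γ(E) = −c₄/c₆ =
148814833/5446162390053` is NOT a square in `ℚ₂₃`: `sqFlagAt 23 (N·D) 0 = false`; `23 ∤ Δ(E′)`); the
place `151` of kind (i) (n1011-p18's instance
`LocalTorsionAway.natCard_ker_nsmul_adicCompletion_eq_one_2718f1_151`, BY NAME).
BINDERS LEFT = the named facts {the seven of the (M)-END, A40 `hU`, A41 `hU2`} ∪ {`hr`, `hq`/`hv`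
(`#Ш_an`)} ∪ {`θ`/`hθ` (the `3`-congruence, r1's KO-certified screen; no Hesse certificate on file),
`hrank` (`2 ≤ rank E′`)} — EVIDENCE columns, not booked.  Numerals re-derived by the seat's stdlib
script `work/pilot/numerals.py` (Euclidean `%`, `//` = Lean's `Int.emod`, `Int.ediv`), each decided
in the kernel below.  NO port, NO Poitou–Tate, NO tower.

References: [CremonaMazur2000] §3 and Table 1; [AgasheStein2002] Thm. 3.1; [Delbourgo1998] Prop. 4;
[Kato2004Asterisque] Thm. 14.5; [MilneADT2006] I.3.8; [SilvermanAEC2009] VII.5.1, X.4.2, X.4.14;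
[SilvermanATAEC1994] IV.9.4, V.5.2–5.4; [Cremona2006] (labels 62514b1, 2718f1).
-/

set_option autoImplicit false

noncomputable section

open scoped Classical NumberField
open IsDedekindDomain NumberField WeierstrassCurve Rat.HeightOneSpectrum
  Literature.NumberTheory.EllipticCurves Literature.NumberTheory.EllipticCurves.ModularForms
  Literature.NumberTheory.EllipticCurves.Rank1Residual
  Literature.NumberTheory.EllipticCurves.Rank1Residual.Typed
  Literature.NumberTheory.GaloisRepresentations
  Summit.BirchSwinnertonDyer.BirchSwinnertonDyer.Rank1Residual.IntModel
  Summit.BirchSwinnertonDyer.BirchSwinnertonDyer.Rank1Residual.X11RankOne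
  Summit.BirchSwinnertonDyer.BirchSwinnertonDyer.Rank2Observatory
  Summit.BirchSwinnertonDyer.BirchSwinnertonDyer.Rank2Observatory.Tam
  Summit.BirchSwinnertonDyer.Rank1Residual.GaloisImage

namespace Summit.BirchSwinnertonDyer.Rank1Residual.Additive

/-- **KIND (iii) NUMERALS for `62514b1 ~ 2718f1` at the place of `2`, decided** (n1011-p17's demo
`LocalTorsion3At.kind_iii_numerals_2718d1_2718f1_at2`, same partner): `γ(E)/γ(E′) = N/D` with
`N = 1829678371735`, `D = 960339968112679`, `2 ∤ N·D`, `sqFlagAt 2 (N·D) 0 = true` (a `2`-adic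
square), and `μ₃(ℚ₂) = 1` (`sqFlagAt 2 (−3) 0 = false`). [cite: SilvermanATAEC1994, Ch. V Lemma 5.2 (c), Thm. 5.3]
[cite: Serre1973, Ch. II §3.3] -/
theorem kind_iii_numerals_62514b1_2718f1_at2 (W E' : WeierstrassCurve ℚ)
    (hW : W = ⟨1, -1, 0, -27902781, 56737833925⟩) (hE' : E' = ⟨1, -1, 0, -99, 409⟩)
    {v : HeightOneSpectrum (𝓞 ℚ)} (hv : (primesEquiv v : ℕ) = 2) :
    (∃ r : v.adicCompletion ℚ, algebraMap ℚ (v.adicCompletion ℚ) (-(W.c₄ / W.c₆)) =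
        r ^ 2 * algebraMap ℚ (v.adicCompletion ℚ) (-(E'.c₄ / E'.c₆))) ∧
      (∀ ζ : v.adicCompletion ℚ, ζ ^ 3 = 1 → ζ = 1) := by
  haveI : Fact (Nat.Prime 2) := ⟨Nat.prime_two⟩
  subst hW; subst hE'
  refine ⟨?_, LocalTorsion3At.forall_pow_three_eq_one_adicCompletion_of_sqFlagAt v hv (w₃ := 0)
    (by norm_num) (by norm_num) (by decide +kernel)⟩
  refine LocalTorsion3At.exists_eq_sq_mul_of_sqFlagAt v hv (N := 1829678371735)
    (D := 960339968112679) ?_ (by norm_num) ?_ (w := 0) (by norm_num) (by norm_num) (by decide +kernel)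
  · norm_num [WeierstrassCurve.c₄, WeierstrassCurve.c₆, WeierstrassCurve.b₂, WeierstrassCurve.b₄,
      WeierstrassCurve.b₆]
  · norm_num [WeierstrassCurve.c₄, WeierstrassCurve.c₆, WeierstrassCurve.b₂, WeierstrassCurve.b₄,
      WeierstrassCurve.b₆]

/-- **NON-SPLIT NUMERAL for `62514b1` at the place of `23`, decided** (kind (iv′)'s conjunct
`¬ IsSquare (ι γ(E))`): `γ(E) = −c₄/c₆ = 148814833/5446162390053`, `23 ∤ N·D`,
`sqFlagAt 23 (N·D) 0 = false` (Euler's criterion on the unit part), via n1011-p17's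
`LocalTorsion3At.not_isSquare_algebraMap_adicCompletion_of_sqFlagAt`.
[cite: SilvermanATAEC1994, Ch. V Thm. 5.3 (b)] [cite: Serre1973, Ch. II §3.3] -/
theorem nonsplit_numeral_62514b1_at23 (W : WeierstrassCurve ℚ)
    (hW : W = ⟨1, -1, 0, -27902781, 56737833925⟩)
    {v : HeightOneSpectrum (𝓞 ℚ)} (hv : (primesEquiv v : ℕ) = 23) :
    ¬ IsSquare (algebraMap ℚ (v.adicCompletion ℚ) (-(W.c₄ / W.c₆))) := by
  haveI : Fact (Nat.Prime 23) := ⟨by norm_num⟩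
  subst hW
  exact LocalTorsion3At.not_isSquare_algebraMap_adicCompletion_of_sqFlagAt v hv (N := 148814833)
    (D := 5446162390053) (by norm_num)
    (by norm_num [WeierstrassCurve.c₄, WeierstrassCurve.c₆, WeierstrassCurve.b₂, WeierstrassCurve.b₄,
      WeierstrassCurve.b₆]) (w := 0) (by norm_num) (by norm_num) (by decide +kernel)

/-- **T-NSK-REC PILOT ROW SHAPE (CLOSES NOTHING, moves no mark): `BSD(E,3)` for `62514b1` from its
`3`-congruent rank-2 partner `2718f1` over the refined seven-kind certificate — the place `3` PAID
(`#E′(ℚ₃)[3] = 1`, budget `3 < 3²`), the place `2` of kind (iii), the place `23` of kind (iv′), the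
place `151` of kind (i); every local binder in the kernel.** [cite: CremonaMazur2000, §3 and Table 1]
[cite: AgasheStein2002, Thm. 3.1] [cite: MilneADT2006, Ch. I Prop. 3.8]
[cite: SilvermanATAEC1994, Ch. V Lemma 5.2 (c), Thm. 5.3, Cor. 5.4]
[cite: SilvermanAEC2009, VII.5 Prop. 5.1, Thm. X.4.2 (a) and X.4.14]
[cite: Cremona2006, Table 1 (labels 62514b1, 2718f1)] -/
theorem bsdp3_visN_v62514b1
    (hKatoS : Kato2004.rankZero_padicValNat_sha_le_sub_localTamagawa_of_additive_potGood_of_imageContainsSL2)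
    (hDel : Delbourgo1998.prop4_rankZero_pow_dvd_constantCoeff)
    (hGZK : rank_eq_analyticRank_of_analyticRank_le_one) (hmod : hasEntireLFunction_rat)
    (hmodD : nonempty_modularParametrizationData)
    (hKatoχ : Wuthrich2014.kato_halfEigenCharIdeal_dvd_cyclotomicPrime_of_surjective)
    (hCT : exists_casselsTate_pairing (K := ℚ))
    (hU : Silverman1994_thmV53_tateUniformisation.{0})
    (hU2 : Silverman1994_thmV53_corV54_tateUniformisation.{0})
    (W : WeierstrassCurve ℚ) [W.IsElliptic] [W.IsGloballyMinimal]
    (hI : integralModelInt W = ⟨1, -1, 0, -27902781, 56737833925⟩)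
    (hr : W.analyticRank = 0)
    {q : ℚ} (hq : shaAn W = (q : ℂ)) (hv : padicValRat 3 q ≤ 2)
    (W' : WeierstrassCurve ℚ) (hW' : W' = ⟨1, -1, 0, -99, 409⟩) [W'.IsElliptic]
    (θ : geomTorsion W' ((3 : ℕ) : ℤ) ≃+ geomTorsion W ((3 : ℕ) : ℤ))
    (hθ : ∀ (σ : Field.absoluteGaloisGroup ℚ) (P : geomTorsion W' ((3 : ℕ) : ℤ)),
      θ (σ • P) = σ • θ P)
    (hrank : 2 ≤ W'.mordellWeilRank) :
    haveI : Fact (Nat.Prime 3) := ⟨Nat.prime_three⟩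
    BSDp W 3 := by
  haveI : Fact (Nat.Prime 3) := ⟨Nat.prime_three⟩
  -- the row `62514b1`
  have hsurj : W.HasSurjectiveModNGaloisRep 3 := GaloisImage.surj3_frob_v62514b1 hI
  have hX : ClassX4 W 3 :=
    ⟨by norm_num, addv_of_intModel hI 3 (by decide) (by decide),
      hasIrreducibleModPGaloisRep_of_hasSurjectiveModNGaloisRep W 3 hsurj⟩
  have hj : padicValRat 3 W.j < 0 :=
    padicValRat_j_neg_of_intModel hI (p := 3) 2 (by decide) (by decide)
  have hE : (⟨1, -1, 0, -27902781, 56737833925⟩ : WeierstrassCurve ℤ).map (Int.castRingHom ℚ) = W := by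
    rw [IntModelTam.eq_baseChange_of_integralModelInt hI]; rfl
  have hW : W = ⟨1, -1, 0, -27902781, 56737833925⟩ := by
    rw [← hE]; exact map_mk_int 1 (-1) 0 (-27902781) 56737833925
  -- the partner `2718f1`: globally minimal, integral model
  haveI hM' : W'.IsGloballyMinimal := by
    rw [hW']
    exact isGloballyMinimal_of_krausCriterion_bounded 1 (-1) 0 (-99) 409
      (by decide +kernel) (by decide +kernel) (by decide +kernel)
  have hI' : integralModelInt W' = ⟨1, -1, 0, -99, 409⟩ := by
    subst hW'; exact integralModelInt_eq_of_map_eq _ (map_mk_int 1 (-1) 0 (-99) 409)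
  have hF : (⟨1, -1, 0, -99, 409⟩ : WeierstrassCurve ℤ).map (Int.castRingHom ℚ) = W' := by
    rw [hW']; exact map_mk_int 1 (-1) 0 (-99) 409
  refine X4RankZero.bsdp_three_potMult_of_congr_of_places₇_of_primeList_paidThree hKatoS hDel hGZK
    hmod hmodD hKatoχ hCT hU hU2 W hr hX hsurj hj hq hv W' θ hθ (t := 1) (k := 2)
    (fun w hw ↦ (LocalTorsion3.natCard_ker_nsmul_three_adicCompletion_eq_one_2718f1 W' hW' hw).le)
    (by norm_num) hrank hE hF [2, 3, 23, 151] (by decide)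
    (X11b.forall_mem_of_natAbs_eq_prod_pow [2, 3, 23, 151] [8, 10, 3, 1] (by decide) (by decide +kernel))
    (X11b.forall_mem_of_natAbs_eq_prod_pow [2, 3, 23, 151] [2, 7, 0, 1] (by decide) (by decide +kernel))
    (fun v hvL hv3 ↦ ?_)
  simp only [List.mem_cons, List.mem_nil_iff, or_false] at hvL
  rcases hvL with h2 | h3 | h23 | h151
  · -- `v = 2`: kind (iii) — both (non-split) multiplicative, same twist class, `μ₃(ℚ₂) = 1`
    have h2z : ((primesEquiv v : ℕ) : ℤ) = ((2 : ℕ) : ℤ) := by rw [h2]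
    refine Or.inr <| Or.inr <| Or.inl ⟨?_, ?_, kind_iii_numerals_62514b1_2718f1_at2 W W' hW hW' h2⟩
    · exact W.hasMultiplicativeReductionAt_of_dvd_of_not_dvd v
        (by rw [minimalDiscriminantInt, hI, h2z]; decide +kernel) (by rw [hI, h2z]; decide +kernel)
    · exact W'.hasMultiplicativeReductionAt_of_dvd_of_not_dvd v
        (by rw [minimalDiscriminantInt, hI', h2z]; decide +kernel) (by rw [hI', h2z]; decide +kernel)
  · -- `v = 3`: the PAID place, excluded here
    exact absurd h3 hv3
  · -- `v = 23`: kind (iv′) — `E` non-split multiplicative, `E′` good, `23 ≠ 3`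
    have h23z : ((primesEquiv v : ℕ) : ℤ) = ((23 : ℕ) : ℤ) := by rw [h23]
    refine Or.inr <| Or.inr <| Or.inr <| Or.inl ⟨?_, nonsplit_numeral_62514b1_at23 W hW h23, ?_, ?_⟩
    · exact W.hasMultiplicativeReductionAt_of_dvd_of_not_dvd v
        (by rw [minimalDiscriminantInt, hI, h23z]; decide +kernel) (by rw [hI, h23z]; decide +kernel)
    · rw [← hF]
      exact hasGoodReductionAt_map_of_not_dvd _ v (by rw [h23z]; decide +kernel)
    · intro hmem
      have h3' := Rat.HeightOneSpectrum.primesEquiv_eq_of_natCast_mem v Nat.prime_three hmem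
      omega
  · -- `v = 151`: kind (i) — the partner is non-split `I₁`, `#E′(ℚ_151)[3] = 1` (p18's instance)
    refine Or.inl ⟨fun hmem ↦ ?_, ?_⟩
    · have h3' := Rat.HeightOneSpectrum.primesEquiv_eq_of_natCast_mem v Nat.prime_three hmem
      omega
    · exact LocalTorsionAway.natCard_ker_nsmul_adicCompletion_eq_one_2718f1_151 W' hW' h151

end Summit.BirchSwinnertonDyer.Rank1Residual.Additive

end
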